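import Summits.CriticalPhenomena.PercolationContinuityZ3.Theorems.PercNearOneGluingNoHeavyQuantGluedWindowDiagCore
import HarnessLib

/-!
# QUANT lane R8, T-DEC: LEMMA W's two-row regime — the LIGHT-second-copy inequalities of the DIAGONAL certificate: the middle copy `l+r` light for its
# partner `h+r` and lighter (`diag_lightMinus`) or not lighter (`diag_lightPlus_half`, floor `y ≤ 1/2`) than the pair at `T₀`; reductions to four / three
# variables by monotonicity and Cauchy–Schwarz, closed by two small Handelman certificates (arm-1 gen 62, architect)

builds on p205010 (kernel theorem, internal audit signed; external expert review pending)

Support file (`--supports stmt-CriticalPhenomena-4575`), QUANT lane seat prim-quant-arm-1 (gen 62, architect); memo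
`run/shared/lean/prim/quant/prim-quant-arm-1-g62/ARCH-G62.md` §2–§3.  Pure real algebra; standard axioms, no sorries, no definitions.

SETTING (as `…QuantGluedWindowDiagCore`): copies `l`, `l+r` of the low atom with weights `t₀(1−γ)`, `t₁(1−γ)`, ratios `ν ≥ y` and `ρ_1 = ν − 2ε < y` (the
second copy LIGHT for `h+r`, virtual heavy ratio `G₁ = y² + (1−y)ρ_1`), giant capacity `γt₂`, `γ = y² + (1−y)ρ₀`.  The a-free band facts (memo §2):
(c12) `t₀ν + t₁(ν−ε) ≤ ρ₀` [top copy unreachable, `a ≤ 1`]; (c11) `(1−y)(ν−ε) ≤ ρ₀` [band2]; (c13) `ε(1+t₂) ≤ νt₂` [band1, band2, `x ≤ qg`].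
* **`diag_lightMinus`** (`ρ_1 ≤ ρ₀`, the second copy needs nothing): `t₀(1−γ/ν) ≤ t₂γ(1−y)/y` from (c12), (c13): `ν ≤ ρ₀(1+t₂)/((1−t₂)+t₀t₂)`, then the
  13-term certificate **`diag_lightMinus_poly`** (kit j310668) in `(y, ρ₀, t₀, t₂)`.
* **`diag_lightPlus_half`** (`ρ₀ ≤ ρ_1 < y`, `y ≤ 1/2`): `t₀(1−γ/ν) + t₁(1−γ/G₁) ≤ t₂γ(1−y)/y` from (c11), (c12): Cauchy–Schwarz (**`diag_cs`**) bounds the left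
  side by `s − γs²/R`, `R = t₀ν + t₁G₁ ≤ ρ₀ − t₁(y−ρ_1)(½−y)`; if `sy ≤ ρ₀` this is `diag_lemmaD`, else `t₁(y−ρ_1) ≥ 2(sy−ρ₀)` and the 16-term certificate
  **`diag_lightPlus_poly`** (kit j310669) in `(y, ρ₀, s)` with `R = 2ρ₀(1−y) − sy(1−2y)`.
Numerical provenance (a-free reduction, exact-status census): explore2/hl.py, hlplus_cs.py, lemD2.py (0 failures; c13 not needed for `+`, c11 not for `−`).

HONEST STATUS.  The case `ρ₀ ≤ ρ_1 < y` with floor `y > 1/2` is NOT covered here (memo §4).  `GluedLemmaW` (flow form), `GluedDominatedMass`, the band,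
`SiblingStep`, `FarTreeRow` OPEN; RATE class (log\*) / honest sentence of `run/shared/lean/prim/quant/README.md` unchanged.  [this work].  Nothing here is
cited as a published result.
-/

namespace Summit.CriticalPhenomena.PercolationContinuityZ3.Theorems
namespace Quant
namespace LawDec

set_option maxRecDepth 200000 in
/-- **cleared polynomial of `diag_lightMinus`** (`r = ρ₀`, `A = (1−t₂) + t₀t₂`): 13-term Handelman certificate (kit j310668) on the generators
`y, 1−y, r, y−r, t₀, t₂−y, t₁ = 1−t₀−t₂, r(1+t₂) − yA`. [this work] -/
theorem diag_lightMinus_poly (y r t0 t2 : ℝ) (h0 : 0 ≤ y) (h1 : 0 ≤ 1 - y) (h2 : 0 ≤ r) (h3 : 0 ≤ y - r) (h4 : 0 ≤ t0) (h5 : 0 ≤ t2 - y) (h6 : 0 ≤ 1 - t0 - t2) (h7 : 0 ≤ r * (1 + t2) - y * ((1 - t2) + t0 * t2)) :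
    0 ≤ t2 * (y ^ 2 + (1 - y) * r) * (1 - y) * r * (1 + t2) - t0 * y * (r * (1 + t2) - (y ^ 2 + (1 - y) * r) * ((1 - t2) + t0 * t2)) := by
  linarith only [mul_nonneg (mul_nonneg (mul_nonneg (mul_nonneg (mul_nonneg (h0) h0) h1) h2) h2) h6,
    mul_nonneg (mul_nonneg (mul_nonneg (mul_nonneg (mul_nonneg (h0) h0) h1) h2) h6) h6,
    mul_nonneg (mul_nonneg (mul_nonneg (mul_nonneg (mul_nonneg (h0) h0) h1) h3) h3) h4,
    mul_nonneg (mul_nonneg (mul_nonneg (mul_nonneg (mul_nonneg (h0) h0) h2) h4) h5) h6,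
    mul_nonneg (mul_nonneg (mul_nonneg (h0) h0) h6) h7,
    mul_nonneg (mul_nonneg (mul_nonneg (mul_nonneg (mul_nonneg (h0) h1) h2) h2) h5) h6,
    mul_nonneg (mul_nonneg (mul_nonneg (mul_nonneg (h0) h1) h3) h3) h4,
    mul_nonneg (mul_nonneg (mul_nonneg (mul_nonneg (mul_nonneg (h0) h1) h3) h3) h4) h5,
    mul_nonneg (mul_nonneg (mul_nonneg (mul_nonneg (h0) h1) h3) h3) h6,
    mul_nonneg (mul_nonneg (mul_nonneg (mul_nonneg (h0) h2) h5) h5) h6,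
    mul_nonneg (mul_nonneg (mul_nonneg (mul_nonneg (h0) h2) h5) h6) h6,
    mul_nonneg (mul_nonneg (mul_nonneg (h0) h3) h5) h7,
    mul_nonneg (mul_nonneg (h2) h5) h7]

/-- **LIGHT-MINUS INEQUALITY** (second copy lighter than the pair at `T₀`: it needs nothing; only the bottom copy ships): `0 < y < 1`, `0 < ρ₀ ≤ y ≤ ν`,
`t₀, t₁ ≥ 0`, `t₂ = 1−t₀−t₁ ≥ y`, (c12) `t₀ν + t₁(ν−ε) ≤ ρ₀`, (c13) `ε(1+t₂) ≤ νt₂` ⟹ `t₀(1 − γ/ν) ≤ t₂·γ·(1−y)/y`. [this work] -/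
theorem diag_lightMinus (y ρ t0 t1 n e : ℝ) (hy0 : 0 < y) (hy1 : y < 1) (hρ0 : 0 < ρ) (hρy : ρ ≤ y) (ht0 : 0 ≤ t0) (ht1 : 0 ≤ t1)
    (ht2 : y ≤ 1 - t0 - t1) (hn : y ≤ n) (hc12 : t0 * n + t1 * (n - e) ≤ ρ) (hc13 : e * (1 + (1 - t0 - t1)) ≤ n * (1 - t0 - t1)) :
    t0 * (1 - (y ^ 2 + (1 - y) * ρ) / n) ≤ (1 - t0 - t1) * (y ^ 2 + (1 - y) * ρ) * ((1 - y) / y) := by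
  obtain ⟨g, hg⟩ : ∃ g : ℝ, g = y ^ 2 + (1 - y) * ρ := ⟨_, rfl⟩
  obtain ⟨t2, ht2d⟩ : ∃ t2 : ℝ, t2 = 1 - t0 - t1 := ⟨_, rfl⟩
  have h1y : 0 < 1 - y := by linarith
  have hg0 : 0 < g := by rw [hg]; positivity
  have hn0 : 0 < n := lt_of_lt_of_le hy0 hn
  rw [← hg, ← ht2d]
  rw [← ht2d] at hc13 ht2
  have ht2p : 0 < t2 := lt_of_lt_of_le hy0 ht2
  -- ν A ≤ ρ (1+t2),  A = (1−t2) + t0 t2 = t0(1+t2) + t1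
  have hA : n * ((1 - t2) + t0 * t2) ≤ ρ * (1 + t2) := by
    have h1t : (1 + t2) ≠ 0 := (show (0:ℝ) < 1 + t2 by linarith).ne'
    have e0 : (t0 * n + t1 * (n / (1 + t2))) * (1 + t2) = t0 * n * (1 + t2) + t1 * n := by
      rw [add_mul, mul_assoc t1, div_mul_cancel₀ _ h1t]
    have e1 : n * ((1 - t2) + t0 * t2) = t0 * n * (1 + t2) + t1 * n := by rw [ht2d]; ring
    have h2 : n / (1 + t2) ≤ n - e := by rw [div_le_iff₀ (by linarith)]; nlinarith
    have h3 : t0 * n + t1 * (n / (1 + t2)) ≤ ρ := by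
      have := mul_le_mul_of_nonneg_left h2 ht1
      linarith
    rw [e1, ← e0]; exact mul_le_mul_of_nonneg_right h3 (by linarith)
  have h7 : 0 ≤ ρ * (1 + t2) - y * ((1 - t2) + t0 * t2) := by nlinarith [mul_le_mul_of_nonneg_right hn (show 0 ≤ (1 - t2) + t0 * t2 by nlinarith)]
  have P := diag_lightMinus_poly y ρ t0 t2 hy0.le h1y.le hρ0.le (by linarith) ht0 (by linarith) (by rw [ht2d]; linarith) h7
  rw [← hg] at P
  -- t0 (1 − g/ν) ≤ t0 (1 − g A/(ρ(1+t2))) ≤ t2 g (1−y)/y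
  have hρt : 0 < ρ * (1 + t2) := by positivity
  have step1 : t0 * (1 - g / n) ≤ t0 * (1 - g * ((1 - t2) + t0 * t2) / (ρ * (1 + t2))) := by
    refine mul_le_mul_of_nonneg_left ?_ ht0
    have : g * ((1 - t2) + t0 * t2) / (ρ * (1 + t2)) ≤ g / n := by
      rw [div_le_div_iff₀ hρt hn0]; nlinarith [mul_le_mul_of_nonneg_left hA hg0.le]
    linarith
  have step2 : t0 * (1 - g * ((1 - t2) + t0 * t2) / (ρ * (1 + t2))) * (y * (ρ * (1 + t2))) ≤ t2 * g * ((1 - y) / y) * (y * (ρ * (1 + t2))) := by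
    have e1 : t0 * (1 - g * ((1 - t2) + t0 * t2) / (ρ * (1 + t2))) * (y * (ρ * (1 + t2)))
        = t0 * y * (ρ * (1 + t2) - g * ((1 - t2) + t0 * t2)) := by
      rw [show t0 * (1 - g * ((1 - t2) + t0 * t2) / (ρ * (1 + t2))) * (y * (ρ * (1 + t2)))
          = t0 * y * (ρ * (1 + t2) - g * ((1 - t2) + t0 * t2) / (ρ * (1 + t2)) * (ρ * (1 + t2))) by ring,
        div_mul_cancel₀ _ hρt.ne']
    have e2 : t2 * g * ((1 - y) / y) * (y * (ρ * (1 + t2))) = t2 * g * (1 - y) * ρ * (1 + t2) := by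
      rw [show t2 * g * ((1 - y) / y) * (y * (ρ * (1 + t2))) = t2 * g * (ρ * (1 + t2)) * ((1 - y) / y * y) by ring, div_mul_cancel₀ _ hy0.ne']
      ring
    rw [e1, e2]; linarith [P]
  exact le_trans step1 (le_of_mul_le_mul_right step2 (by positivity))

/-- **Cauchy–Schwarz for two copies**: `γ ≥ 0`, `ρ_a, ρ_b > 0`, `t₀, t₁ ≥ 0`, `t₀ + t₁ > 0`:
`t₀(1 − γ/ρ_a) + t₁(1 − γ/ρ_b) ≤ (t₀+t₁) − γ(t₀+t₁)²/(t₀ρ_a + t₁ρ_b)`. [folklore] -/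
theorem diag_cs (g t0 t1 ra rb : ℝ) (hg : 0 ≤ g) (ht0 : 0 ≤ t0) (ht1 : 0 ≤ t1) (hs : 0 < t0 + t1) (hra : 0 < ra) (hrb : 0 < rb) :
    t0 * (1 - g / ra) + t1 * (1 - g / rb) ≤ (t0 + t1) - g * (t0 + t1) ^ 2 / (t0 * ra + t1 * rb) := by
  obtain ⟨u, hu⟩ : ∃ u : ℝ, u = t0 / ra := ⟨_, rfl⟩
  obtain ⟨v, hv⟩ : ∃ v : ℝ, v = t1 / rb := ⟨_, rfl⟩
  have hu0 : 0 ≤ u := by rw [hu]; positivity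
  have hv0 : 0 ≤ v := by rw [hv]; positivity
  have et0 : t0 = u * ra := by rw [hu, div_mul_cancel₀ _ hra.ne']
  have et1 : t1 = v * rb := by rw [hv, div_mul_cancel₀ _ hrb.ne']
  have hR : 0 < t0 * ra + t1 * rb := by
    rcases lt_or_ge 0 t0 with h | h
    · exact add_pos_of_pos_of_nonneg (mul_pos h hra) (mul_nonneg ht1 hrb.le)
    · have : 0 < t1 := by linarith [le_antisymm h ht0]
      exact add_pos_of_nonneg_of_pos (mul_nonneg ht0 hra.le) (mul_pos this hrb)
  have eL : t0 * (1 - g / ra) + t1 * (1 - g / rb) = (t0 + t1) - g * (u + v) := by rw [et0, et1]; field_simp; ring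
  have hCS : (t0 + t1) ^ 2 ≤ (u + v) * (t0 * ra + t1 * rb) := by
    have e : (u + v) * (t0 * ra + t1 * rb) - (t0 + t1) ^ 2 = u * v * (ra - rb) ^ 2 := by rw [et0, et1]; ring
    nlinarith [mul_nonneg (mul_nonneg hu0 hv0) (sq_nonneg (ra - rb))]
  have h1 : g * (t0 + t1) ^ 2 / (t0 * ra + t1 * rb) ≤ g * (u + v) := by
    rw [div_le_iff₀ hR, mul_assoc]; exact mul_le_mul_of_nonneg_left hCS hg
  rw [eL]; linarith

set_option maxRecDepth 200000 in
/-- **cleared polynomial of `diag_lightPlus_half`, case `sy > ρ₀`** (`r = ρ₀`, `R = 2r(1−y) − sy(1−2y)`): 16-term Handelman certificate (kit j310669) on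
`y, ½−y, r, y−r, s, 1−y−s, sy−r, 2r − s(y+r), r(1+y) − y(1−y)`. [this work] -/
theorem diag_lightPlus_poly (y r s : ℝ) (h0 : 0 ≤ y) (h1 : 0 ≤ 1 / 2 - y) (h2 : 0 ≤ r) (h3 : 0 ≤ y - r) (h4 : 0 ≤ s) (h5 : 0 ≤ 1 - y - s) (h6 : 0 ≤ s * y - r) (h7 : 0 ≤ 2 * r - s * (y + r)) (h8 : 0 ≤ r * (1 + y) - y * (1 - y)) :
    0 ≤ (y ^ 2 + (1 - y) * r) * y * s ^ 2 - (2 * r * (1 - y) - s * y * (1 - 2 * y)) * (y * s - (1 - s) * (y ^ 2 + (1 - y) * r) * (1 - y)) := by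
  linarith only [mul_nonneg (mul_nonneg (mul_nonneg (mul_nonneg (mul_nonneg (h0) h0) h0) h3) h4) h6,
    mul_nonneg (mul_nonneg (mul_nonneg (mul_nonneg (mul_nonneg (h0) h0) h2) h3) h4) (by norm_num : (0:ℝ) ≤ 3/8),
    mul_nonneg (mul_nonneg (mul_nonneg (mul_nonneg (h0) h0) h2) h7) (by norm_num : (0:ℝ) ≤ 1/8),
    mul_nonneg (mul_nonneg (mul_nonneg (mul_nonneg (mul_nonneg (h0) h0) h3) h5) h6) (by norm_num : (0:ℝ) ≤ 2),
    mul_nonneg (mul_nonneg (mul_nonneg (mul_nonneg (mul_nonneg (h0) h1) h1) h3) h4) h6,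
    mul_nonneg (mul_nonneg (mul_nonneg (mul_nonneg (h0) h1) h3) h7) (by norm_num : (0:ℝ) ≤ 1/2),
    mul_nonneg (mul_nonneg (mul_nonneg (mul_nonneg (h0) h2) h3) h5) (by norm_num : (0:ℝ) ≤ 1/2),
    mul_nonneg (mul_nonneg (mul_nonneg (mul_nonneg (h0) h2) h5) h6) (by norm_num : (0:ℝ) ≤ 7/4),
    mul_nonneg (mul_nonneg (mul_nonneg (h0) h3) h7) (by norm_num : (0:ℝ) ≤ 1/4),
    mul_nonneg (mul_nonneg (mul_nonneg (mul_nonneg (mul_nonneg (h1) h1) h2) h4) h6) (by norm_num : (0:ℝ) ≤ 2),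
    mul_nonneg (mul_nonneg (mul_nonneg (h1) h6) h6) (by norm_num : (0:ℝ) ≤ 3/4),
    mul_nonneg (mul_nonneg (mul_nonneg (mul_nonneg (h2) h4) h4) h6) (by norm_num : (0:ℝ) ≤ 1/2),
    mul_nonneg (mul_nonneg (mul_nonneg (mul_nonneg (h3) h5) h5) h6) (by norm_num : (0:ℝ) ≤ 1/2),
    mul_nonneg (mul_nonneg (mul_nonneg (h5) h6) h6) (by norm_num : (0:ℝ) ≤ 1/2),
    mul_nonneg (mul_nonneg (h6) h6) (by norm_num : (0:ℝ) ≤ 9/8),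
    mul_nonneg (mul_nonneg (h6) h8) (by norm_num : (0:ℝ) ≤ 1/2)]

/-- **LIGHT-PLUS INEQUALITY, floor `y ≤ 1/2`** (second copy light for `h+r`, not lighter than the pair at `T₀`): `0 < y ≤ 1/2`, `0 < ρ₀ ≤ ρ_1 ≤ y ≤ ν`,
`G₁ = y² + (1−y)ρ_1`, `t₀, t₁ ≥ 0`, `t₀ + t₁ ≤ 1 − y`, (c11) `(1−y)(ν+ρ_1) ≤ 2ρ₀`, (c12) `2t₀ν + t₁(ν+ρ_1) ≤ 2ρ₀` ⟹
`t₀(1 − γ/ν) + t₁(1 − γ/G₁) ≤ (1−t₀−t₁)·γ·(1−y)/y`. [this work] -/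
theorem diag_lightPlus_half (y ρ ρ1 t0 t1 n : ℝ) (hy0 : 0 < y) (hyh : y ≤ 1 / 2) (hρ0 : 0 < ρ) (hρ1 : ρ ≤ ρ1) (hρ1y : ρ1 ≤ y) (hn : y ≤ n)
    (ht0 : 0 ≤ t0) (ht1 : 0 ≤ t1) (hs1 : t0 + t1 ≤ 1 - y) (hc11 : (1 - y) * (n + ρ1) ≤ 2 * ρ) (hc12 : 2 * t0 * n + t1 * (n + ρ1) ≤ 2 * ρ) :
    t0 * (1 - (y ^ 2 + (1 - y) * ρ) / n) + t1 * (1 - (y ^ 2 + (1 - y) * ρ) / (y ^ 2 + (1 - y) * ρ1))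
      ≤ (1 - t0 - t1) * (y ^ 2 + (1 - y) * ρ) * ((1 - y) / y) := by
  obtain ⟨g, hg⟩ : ∃ g : ℝ, g = y ^ 2 + (1 - y) * ρ := ⟨_, rfl⟩
  obtain ⟨G1, hG1⟩ : ∃ G1 : ℝ, G1 = y ^ 2 + (1 - y) * ρ1 := ⟨_, rfl⟩
  have hy1 : y < 1 := by linarith
  have h1y : 0 < 1 - y := by linarith
  have hg0 : 0 < g := by rw [hg]; positivity
  have hn0 : 0 < n := lt_of_lt_of_le hy0 hn
  have hρ10 : 0 ≤ ρ1 := by linarith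
  have hG10 : 0 < G1 := by rw [hG1]; positivity
  have hρy : ρ ≤ y := le_trans hρ1 hρ1y
  rw [← hg, ← hG1]
  set s := t0 + t1 with hs
  rcases eq_or_lt_of_le (show 0 ≤ s by rw [hs]; linarith) with hs0 | hs0
  · -- s = 0: both t's vanish
    have e0 : t0 = 0 := by linarith
    have e1 : t1 = 0 := by linarith
    rw [e0, e1]; simp only [zero_mul, add_zero, sub_zero, one_mul]
    exact mul_nonneg hg0.le (div_nonneg h1y.le hy0.le)
  -- Cauchy–Schwarz
  have hCS := diag_cs g t0 t1 n G1 hg0.le ht0 ht1 hs0 hn0 hG10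
  rw [← hs] at hCS
  obtain ⟨R, hR⟩ : ∃ R : ℝ, R = t0 * n + t1 * G1 := ⟨_, rfl⟩
  rw [← hR] at hCS
  have hRpos : 0 < R := by
    rw [hR]; rcases lt_or_ge 0 t0 with h | h
    · exact add_pos_of_pos_of_nonneg (mul_pos h hn0) (mul_nonneg ht1 hG10.le)
    · have : 0 < t1 := by linarith [le_antisymm h ht0]
      exact add_pos_of_nonneg_of_pos (mul_nonneg ht0 hn0.le) (mul_pos this hG10)
  -- R ≤ ρ − t1 (y − ρ1)(1/2 − y)
  have hRb : R ≤ ρ - t1 * (y - ρ1) * (1 / 2 - y) := by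
    have e1 : R = (t0 * n + t1 * ((n + ρ1) / 2)) + t1 * (G1 - (n + ρ1) / 2) := by rw [hR]; ring
    have h2 : G1 - (n + ρ1) / 2 ≤ -((y - ρ1) * (1 / 2 - y)) := by rw [hG1]; nlinarith
    have h3 : t0 * n + t1 * ((n + ρ1) / 2) ≤ ρ := by linarith
    rw [e1]; nlinarith [mul_le_mul_of_nonneg_left h2 ht1]
  -- monotonicity in R of s − g s²/R
  have mono : ∀ R' : ℝ, R ≤ R' → s - g * s ^ 2 / R ≤ s - g * s ^ 2 / R' := by
    intro R' hRR'
    have hR'0 : 0 < R' := lt_of_lt_of_le hRpos hRR'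
    have : g * s ^ 2 / R' ≤ g * s ^ 2 / R := div_le_div_of_nonneg_left (by positivity) hRpos hRR'
    linarith
  have e14 : 1 - t0 - t1 = 1 - s := by rw [hs]; ring
  rw [e14]
  by_cases hsy : s * y ≤ ρ
  · -- R ≤ ρ and Lemma D
    have hRρ : R ≤ ρ := by nlinarith [mul_nonneg (mul_nonneg ht1 (sub_nonneg.2 hρ1y)) (show (0:ℝ) ≤ 1 / 2 - y by linarith)]
    have hD := diag_lemmaD y ρ s hy0 hy1 hρ0 (by rw [hs]; exact hs1) hsy
    rw [← hg] at hD
    have hD' : s - g * s ^ 2 / ρ ≤ (1 - s) * g * ((1 - y) / y) := by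
      have e1 : (s - g * s ^ 2 / ρ) * (ρ * y) = y * (s * ρ - g * s ^ 2) := by
        rw [sub_mul, show g * s ^ 2 / ρ * (ρ * y) = (g * s ^ 2 / ρ * ρ) * y by ring, div_mul_cancel₀ _ hρ0.ne']; ring
      have e2 : (1 - s) * g * ((1 - y) / y) * (ρ * y) = (1 - s) * g * (1 - y) * ρ := by
        rw [show (1 - s) * g * ((1 - y) / y) * (ρ * y) = (1 - s) * g * ρ * ((1 - y) / y * y) by ring, div_mul_cancel₀ _ hy0.ne']; ring
      refine le_of_mul_le_mul_right ?_ (mul_pos hρ0 hy0)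
      rw [e1, e2]; exact hD
    linarith [hCS, mono ρ hRρ, hD']
  · -- s y > ρ: R ≤ 2ρ(1−y) − s y (1−2y) and the certificate
    have hsy' : ρ < s * y := lt_of_not_ge hsy
    have hτ : 2 * (s * y - ρ) ≤ t1 * (y - ρ1) := by rw [hs]; nlinarith [mul_le_mul_of_nonneg_left hn ht0, mul_le_mul_of_nonneg_left hn ht1]
    have hτ' : t1 * (y - ρ1) ≤ s * (y - ρ) := by
      rw [hs]; nlinarith [mul_le_mul_of_nonneg_left hρ1 ht1, mul_nonneg ht0 (sub_nonneg.2 hρy)]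
    obtain ⟨R2, hR2⟩ : ∃ R2 : ℝ, R2 = 2 * ρ * (1 - y) - s * y * (1 - 2 * y) := ⟨_, rfl⟩
    have hRR2 : R ≤ R2 := by
      rw [hR2]; nlinarith [hRb, mul_le_mul_of_nonneg_right hτ (show (0:ℝ) ≤ 1 / 2 - y by linarith)]
    have hR20 : 0 < R2 := lt_of_lt_of_le hRpos hRR2
    have h7 : 0 ≤ 2 * ρ - s * (y + ρ) := by
      have e : s * (y + ρ) = s * y + s * ρ := by ring
      have e' : s * (y - ρ) = s * y - s * ρ := by ring
      linarith [le_trans hτ hτ', e, e']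
    have h8 : 0 ≤ ρ * (1 + y) - y * (1 - y) := by
      have h1 := mul_le_mul_of_nonneg_left (add_le_add hn hρ1) h1y.le
      have e : (1 - y) * (y + ρ) = y * (1 - y) + ρ - ρ * y := by ring
      have e' : ρ * (1 + y) = ρ + ρ * y := by ring
      linarith [h1, hc11, e, e']
    have P := diag_lightPlus_poly y ρ s hy0.le (by linarith) hρ0.le (by linarith) hs0.le (by rw [hs]; linarith) (by linarith) h7 h8
    rw [← hg, ← hR2] at P
    have hfin : s - g * s ^ 2 / R2 ≤ (1 - s) * g * ((1 - y) / y) := by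
      have e1 : (s - g * s ^ 2 / R2) * (R2 * y) = y * s * R2 - g * y * s ^ 2 := by
        rw [sub_mul, show g * s ^ 2 / R2 * (R2 * y) = (g * s ^ 2 / R2 * R2) * y by ring, div_mul_cancel₀ _ hR20.ne']; ring
      have e2 : (1 - s) * g * ((1 - y) / y) * (R2 * y) = (1 - s) * g * (1 - y) * R2 := by
        rw [show (1 - s) * g * ((1 - y) / y) * (R2 * y) = (1 - s) * g * R2 * ((1 - y) / y * y) by ring, div_mul_cancel₀ _ hy0.ne']; ring
      refine le_of_mul_le_mul_right ?_ (mul_pos hR20 hy0)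
      rw [e1, e2]; linarith [P]
    linarith [hCS, mono R2 hRR2, hfin]

end LawDec
end Quant
end Summit.CriticalPhenomena.PercolationContinuityZ3.Theorems
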